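import Summits.ABC.IUTFork.Cor312PinnedRegionsThreePins
import Summits.ABC.IUTFork.Cor312PilotIdelesPrCapstone
import Summits.ABC.IUTFork.Cor312ProvenanceGenuine
import Summits.ABC.IUTFork.Thm311Real3
import Summits.ABC.IUTFork.LDHGenuinePoint
import Summits.ABC.ABC.Theorems.IUTThetaPilotABCOfCor312
import HarnessLib

/-!
# Branch C, the PER-IMAGE engine AT THE GENUINE REAL SETTING OF THE DATUM — `hq` and (ii)(b) discharged by name;
# what remains per datum is S + the two region pins + the per-image Θ-side reading + q-idele side conditions (`abc_of_S_perImage_genuine`)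

C scoreboard, per-image S-line at the genuine setting (`abc_of_S_perImage_genuine`): S 1 · PIN 1 · FACT 0 · CONE 0 · READ 1 · SIDE 4 = 7
(explicit, per datum) — and NO `(P, l)`-level binder at all: v2's / Shrink2's `hvol` ((ii′), VERDICT RISK ¶7) is not on this path.
Reference: `Conditional/AbcOfSShrink2.lean` (abc-iut-C-cert-3, p430322): S 1 · PIN 1 · FACT 0 · CONE 0 · READ 1 · SIDE 6 = 9 per datum PLUS
the `(P, l)`-level CONE binder `hvol` = 10.

PROOF-ONLY companion (no `def`, no new `Prop`) by the S-layer seat abc-iut-S-d1 (gen 5): the instantiation of `Conditional/AbcOfSPerImage.lean`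
(p432418: S ⟺ READING 3 pins the q-pilot to ONE global possible image, so the per-image Θ-side reading `hΘP` and `hq` give
`Cor312PerImageOf` with no volume estimate) at abc-iut-c312-7's print-normalised assembled REAL setting `settingPrVolSharp X …` of the
initial Θ-data `D`, exactly as `AbcOfSShrink2` instantiates v2 there. Per datum (`D` with a genuine volume input `I` OF `D`):

* DATA: Dupuy–Hilado pilot data `X` OF `D` over `D`'s field `F`, the context binders of `settingPrVolSharp` (as in Shrink1/Shrink2), the
  Θ-ideles `t` and q-ideles `tq`, PR-1's `ρ`, `qK`;
* DISCHARGED BY NAME: [CONE] `hKumB` := `rfl` (Thm. 3.11 (ii)(b) at column `n` in c312-5's strictified reading — CAVEAT as in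
  Shrink1/Shrink2: non-identity Kummer transport is not represented, campaign M); [READ] `hq` := c312-7's
  `negLogQ_settingPrVolSharp_eq_neg_absLogq` (p424856/p427219 lineage: `−|log(q)|` of the setting `= −(1/2l)·log(q)` of `D` when the
  q-ideles REALISE `P_q`) ∘ c312-8's `Cor312Prov.negAbsLogQ_eq_neg_absLogq_of_isVolumeInputOf` (p413743);
* NOT NEEDED on this path (compared with Shrink2): [PIN] `hBridge` / `ThetaFinite` (hence NO Θ-idele conditions `ht0`, `ht1`), and the
  `(P, l)`-level [CONE] `hvol`;
* REMAINING, per datum: [S] `hS` · [PIN] `hPin` (two pins) · [READ] `hΘP` = «every global possible image of the genuine setting has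
  procession-normalised log-volume ≤ `I.negLogThetaPerImage`» (the per-image twin of the C lead's G1 Θ-half; container comparison,
  OPEN like it; presupposes no estimate) · [SIDE] `hX`, `htq0`, `htq1`, `htq` (the q-ideles REALISE `P_q` — `htq` ALONE is satisfiable
  iff `2l ∣ ord_v(q_v)` on `S`, abc-iut-c312-3 `exists_realising_qIdeles`, p420764; but JOINTLY WITH `hX` AT F-LEVEL THE SIDE CLASS IS
  UNSATISFIABLE AS TYPED — C-cert-3's FINDING F1 `Shrink2.sideConditions_false` p432420, and for THIS file's own binders abc-iut-w6-d110's
  `abc_of_S_perImage_genuine_sideConditions_false` p435435 — so `abc_of_S_perImage_genuine` is VACUOUS AS TYPED by its SIDE class alone,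
  exactly like `abc_of_S_shrink2`; the recorded F-vs-K typing SEAM of Shrink2's docstring; repair = the K-level provenance of C-cert-3's v5,
  at which this file is to be re-keyed; the abstract per-image lines of `AbcOfSPerImage.lean` / `AbcOfSPerImageHull.lean` carry no SIDE class).

§2 `abc_of_S_perImage_genuine` folds §1 under each datum `T`'s bundled instances into abc-iut-S2's `ABC_of_cor312PerImage`
(ONLY hypothesis `Cor22.Cor312PerImageAtDatum`; the per-image hull estimate (ii′-P) `ThetaPartII.stub_hullVolumePerImage` p425589 is a
THEOREM at every datum). MOVEMENT Shrink2 → here: per datum explicit 9 → 7 (SIDE 6 → 4, READ `hΘ` ↦ `hΘP`), and the `(P, l)`-level `hvol`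
GONE: the substantive classes S + PIN + CONE + READ: Shrink2's 4 (`hS`, `hPin`, `hvol`, `hΘ`) → 3 (`hS`, `hPin`, `hΘP`).

WHAT THIS DOES NOT CHANGE (C-R10a, 2026-08-26T07:26:50Z): at these very data, once the Θ-ideles `t` are also taken REALISING and
Thm. 3.11 (ii)(b) holds at the column, the antecedent S ∧ pins is KERNEL-REFUTED for every `ρ`, `qK`
(`Cor312Vol.PinnedHonestReal.not_pilotKummerIndRelated_settingPrVolSharp_of_pinned`, p430714) — a COMPOSITION RECORD, not a live
route. The record it completes: on the S-line, AT THE GENUINE SETTING, the volume side contributes NO open hypothesis.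

HONEST FRAMING: this campaign LOCATES / CONDITIONALLY VERIFIES. Nothing here asserts that abc is proved or refuted, that [IUTchIII]
Cor. 3.12 (in either reading) or Thm. 3.11 holds or fails, or takes a side on (U) vs (P) or on any author (Mochizuki / Scholze–Stix /
Joshi / Dupuy–Hilado); «`ABC` follows from S + the listed hypotheses AS TYPED, at these data», nothing more; S is an assumption label;
typed ≠ proved; instantiated ≠ endorsed. [claim: Mochizuki2012, status: disputed] [cite: DupuyHilado2025, §3.3–§3.4]
[cite: Mochizuki2012, IUTchIII Cor. 3.12 p. 173–174, Step (x) p. 181; IUTchIV Thm. 1.10 p. 23]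
-/

noncomputable section

open Set Function NumberField IsDedekindDomain

namespace Summit.ABC.IUTFork.Conditional

open Thm311 Thm311.Real Cor312 Cor312Vol Cor312Prov Literature.IUT.LogThetaLattice Literature.IUT.LogVolume
  Literature.IUT.HodgeTheaters Literature.IUT.LogVolume.ThetaData

/-! ## §1. One datum: `I.Cor312PerImageOf` at the genuine real setting of `D` from S + two pins + the per-image Θ-reading + q-idele side conditions -/

section PerDatum

variable {F K Fbar : Type} [Field F] [NumberField F] [Field K] [NumberField K] [Algebra F K] [Field Fbar]
  [Algebra F Fbar] [Algebra K Fbar] {E : WeierstrassCurve F} [E.IsElliptic] {l : ℕ} {Pb : BadPlacePredicates K}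
  (D : InitialThetaData F K Fbar E l Pb) {I : ThetaVolumeInput (fieldOfModuli E) K}
  (X : PilotData F) (M : Type) [Field M] [NumberField M]
  (archPk : ∀ (j : (thetaIndex X).Label) (vQ : (thetaIndex X).VQ), Set ((logShellsDH X (analyticLogv F)).Packet j vQ))
  (archSub : ∀ (j : (thetaIndex X).Label) (v : (thetaIndex X).V),
    Set ((logShellsDH X (analyticLogv F)).Packet j ((thetaIndex X).over v)))
  (Ψ : ℤ → ∀ v : (thetaIndex X).V, v ∈ (thetaIndex X).Vbad → Set ((logShellsDH X (analyticLogv F)).StarPacket v))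
  (act : ℤ → ∀ v : (thetaIndex X).V, v ∈ (thetaIndex X).Vbad →
    (logShellsDH X (analyticLogv F)).StarPacket v → Module.End ℚ ((logShellsDH X (analyticLogv F)).StarPacket v))
  (Mmod : ℤ → ∀ j : (thetaIndex X).LabelStar, Set ((logShellsDH X (analyticLogv F)).GlobalPacket j.1))
  (region : ℤ → ∀ j : (thetaIndex X).LabelStar, FinDivisor M → ∀ vQ : (thetaIndex X).VQ,
    Set ((logShellsDH X (analyticLogv F)).Packet j.1 vQ))
  (frobAdm : ℤ → ℤ → ∀ (j : (thetaIndex X).Label) (vQ : (thetaIndex X).VQ),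
    Set ((logShellsDH X (analyticLogv F)).Packet j vQ) → Prop)
  (frobLogvol : ℤ → ℤ → ∀ (j : (thetaIndex X).Label) (vQ : (thetaIndex X).VQ),
    Set ((logShellsDH X (analyticLogv F)).Packet j vQ) → ℝ)
  (frobMmod : ℤ → ℤ → ∀ j : (thetaIndex X).LabelStar, Set ((logShellsDH X (analyticLogv F)).GlobalPacket j.1))
  (unitImage : ℤ → ℤ → ℕ → ∀ (j : (thetaIndex X).Label) (vQ : (thetaIndex X).VQ),
    Set ((logShellsDH X (analyticLogv F)).Packet j vQ))
  (ballImage : ℤ → ℤ → ∀ (j : (thetaIndex X).Label) (vQ : (thetaIndex X).VQ),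
    Set ((logShellsDH X (analyticLogv F)).Packet j vQ))
  (thetaDiv : ℤ → ℤ → LgpDivisor M (thetaIndex X).lstar)
  (n : ℤ) {HT : Type} {LogLink : HT → HT → Type} {IsFull : ∀ {s t : HT}, LogLink s t → Prop}
  (lat : LGPGaussianLogThetaLattice LogLink IsFull)
  {Frd : Type} {IsoF : Frd → Frd → Type} {Ob : Frd → Type} {realify : Frd → Frd} {Strip : Type}
  {IsoS : Strip → Strip → Type} {Mv : ∀ v : (thetaIndex X).V, v ∈ (thetaIndex X).Vbad → Type}
  [∀ v h, Monoid (Mv v h)]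
  (sig : GlobalLGPFrobenioidSignature (thetaIndex X).lstar (thetaIndex X).V (· ∈ (thetaIndex X).Vbad)
    Frd IsoF Ob realify Strip IsoS Mv)
  (split : SplittingMonoids Mv) {ObΔ : Type} {N : ∀ v : (thetaIndex X).V, v ∈ (thetaIndex X).Vbad → Type}
  [∀ v h, Monoid (N v h)] (qData : QPilotData ObΔ N)
  (t : ∀ (pp : Nat.Primes) (_ : Fin X.lstar) (x : (thetaIndex X).Fibre (.inr pp)),
    haveI : Fact (pp : ℕ).Prime := ⟨pp.2⟩; kOf X pp.1 x)
  (tq : ∀ (pp : Nat.Primes) (x : (thetaIndex X).Fibre (.inr pp)), haveI : Fact (pp : ℕ).Prime := ⟨pp.2⟩; kOf X pp.1 x)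
  (ρ : (∀ v : (thetaIndex X).V, v ∈ (thetaIndex X).Vbad → Set ((logShellsDH X (analyticLogv F)).StarPacket v)) →
    ∀ (j : (thetaIndex X).Label) (vQ : (thetaIndex X).VQ), Set ((logShellsDH X (analyticLogv F)).Packet j vQ))
  (qK : ∀ v : (thetaIndex X).V, v ∈ (thetaIndex X).Vbad → Set ((logShellsDH X (analyticLogv F)).StarPacket v))


/-- **One datum, genuine real setting, PER-IMAGE line: `I.Cor312PerImageOf` (`−|log(q)| ≤ −|log(Θ)|_(P)` for the DEFINED numbers of a
genuine Θ-volume input `I` OF the initial Θ-data `D`) FROM: S (`PilotKummerIndRelated`), the two region pins, the per-image Θ-side reading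
`hΘP`, and the q-idele side conditions (`hX`, `htq0`, `htq1`, `htq`) — NO `BridgeHyps`/`ThetaFinite`, NO Θ-idele condition, NO volume
estimate.** Route, by name: Thm. 3.11 (ii)(b)@n := `rfl` + PR-1 `reading3_iff_pilotKummerIndRelated` ⟹ READING 3 at the genuine setting;
the definitional unfolding of `negLogQ` (as `PerImage.negLogQ_le_of_reading3'`, p432418) with `hΘP`; q-side: c312-7 `negLogQ_settingPrVolSharp_eq_neg_absLogq` + c312-8
`negAbsLogQ_eq_neg_absLogq_of_isVolumeInputOf`. «`I.Cor312PerImageOf` follows from S + these hypotheses as typed, at these data» — no side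
taken. [claim: Mochizuki2012, status: disputed] -/
theorem PerImage.cor312PerImageOf_of_S_genuine (hI : ThetaData.IsVolumeInputOf D I) (hX : Cor312Prov.IsPilotDataOf D X)
    (htq0 : ∀ pp x, tq pp x ≠ 0)
    (htq1 : ∀ (pp : Nat.Primes) (x : (thetaIndex X).Fibre (.inr pp)),
      haveI : Fact (pp : ℕ).Prime := ⟨pp.2⟩; placeOf X pp.1 x ∉ X.S → ‖tq pp x‖ = 1)
    (htq : ∀ (pp : Nat.Primes) (x : (thetaIndex X).Fibre (.inr pp)),
      haveI : Fact (pp : ℕ).Prime := ⟨pp.2⟩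
      Real.log ‖tq pp x‖ = -(X.qPilot (placeOf X pp.1 x)) * logNorm F (placeOf X pp.1 x) /
        localDegree F (placeOf X pp.1 x))
    (hS : Cor312Vol.PilotKummerIndRelated
      (LatticeSituation.ofShells (logShellsDH X (analyticLogv F)) M archPk archSub
        (summandPiecesPr X (logvAnalytic_analyticLogv (F := F))).Adm
        (summandPiecesPr X (logvAnalytic_analyticLogv (F := F))).logvol Ψ act Mmod region frobAdm frobLogvol
        (fun k _ => Ψ k) frobMmod unitImage ballImage thetaDiv)
      (settingPrVolSharp X (logvAnalytic_analyticLogv (F := F)) M archPk archSub Ψ act Mmod region n lat sig split qData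
        tq t htq0 htq1) ρ qK)
    (hPin : Cor312Vol.PinnedRegions
      (LatticeSituation.ofShells (logShellsDH X (analyticLogv F)) M archPk archSub
        (summandPiecesPr X (logvAnalytic_analyticLogv (F := F))).Adm
        (summandPiecesPr X (logvAnalytic_analyticLogv (F := F))).logvol Ψ act Mmod region frobAdm frobLogvol
        (fun k _ => Ψ k) frobMmod unitImage ballImage thetaDiv)
      (settingPrVolSharp X (logvAnalytic_analyticLogv (F := F)) M archPk archSub Ψ act Mmod region n lat sig split qData
        tq t htq0 htq1) ρ qK)
    (hΘP : ∀ U : ImageChoice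
        (settingPrVolSharp X (logvAnalytic_analyticLogv (F := F)) M archPk archSub Ψ act Mmod region n lat sig split qData
          tq t htq0 htq1),
      processionNormalized (fun i : Fin (thetaIndex X).lstar =>
        ∑ᶠ vQ : (thetaIndex X).VQ,
          ((LatticeSituation.ofShells (logShellsDH X (analyticLogv F)) M archPk archSub
              (summandPiecesPr X (logvAnalytic_analyticLogv (F := F))).Adm
              (summandPiecesPr X (logvAnalytic_analyticLogv (F := F))).logvol Ψ act Mmod region frobAdm frobLogvol
              (fun k _ => Ψ k) frobMmod unitImage ballImage thetaDiv).D
            (settingPrVolSharp X (logvAnalytic_analyticLogv (F := F)) M archPk archSub Ψ act Mmod region n lat sig split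
              qData tq t htq0 htq1).n).logvol (Setting.labelSucc i) vQ (U.1 (i, vQ))) ≤ I.negLogThetaPerImage) :
    I.Cor312PerImageOf := by
  -- Step 1: READING 3 at the genuine setting — hKumB := rfl, R3 ⟸ S under the two pins
  have h3 := (Cor312Vol.reading3_iff_pilotKummerIndRelated
    (LatticeSituation.ofShells (logShellsDH X (analyticLogv F)) M archPk archSub
      (summandPiecesPr X (logvAnalytic_analyticLogv (F := F))).Adm
      (summandPiecesPr X (logvAnalytic_analyticLogv (F := F))).logvol Ψ act Mmod region frobAdm frobLogvol
      (fun k _ => Ψ k) frobMmod unitImage ballImage thetaDiv)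
    (settingPrVolSharp X (logvAnalytic_analyticLogv (F := F)) M archPk archSub Ψ act Mmod region n lat sig split qData
      tq t htq0 htq1) ρ qK (fun _ _ _ => rfl) hPin).2 hS
  -- Step 2: the q-pilot regions ARE one global possible image, and `negLogQ` is DEFINITIONALLY the procession-normalised
  -- sum of their log-volumes (`Conditional/AbcOfSPerImage.lean` §1, inlined to keep this file import-light)
  have hle : (settingPrVolSharp X (logvAnalytic_analyticLogv (F := F)) M archPk archSub Ψ act Mmod region n lat sig split
      qData tq t htq0 htq1).negLogQ ≤ I.negLogThetaPerImage := by
    unfold Setting.negLogQ Setting.qLocal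
    exact hΘP ⟨fun s => _, fun s => h3 (Setting.labelSucc s.1) s.2⟩
  -- Step 3: the q-side by provenance — `−|log(q)|` of the setting and of the input are both `−(1/2l)·log(q)` of `D`
  rw [negLogQ_settingPrVolSharp_eq_neg_absLogq X (logvAnalytic_analyticLogv (F := F)) M archPk archSub Ψ act Mmod
    region n lat sig split qData t tq hX htq0 htq1 htq] at hle
  show I.negAbsLogQ ≤ I.negLogThetaPerImage
  rw [Cor312Prov.negAbsLogQ_eq_neg_absLogq_of_isVolumeInputOf D hI]
  exact hle

end PerDatum

/-! ## §2. The apex: `ABC` on the per-image S-line with the per-datum group AT THE GENUINE REAL SETTING — no `hvol`, no `hΘ`, no Θ-idele condition -/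

section Family

open Literature.NumberTheory.DiophantineGeometry.GenEll Summit.ABC.ABC.Theorems

/-- **`abc_of_S_perImage_genuine` (branch C, per-image S-line AT THE GENUINE REAL SETTING OF EACH DATUM; per datum explicit
S 1 · PIN 1 · FACT 0 · CONE 0 · READ 1 · SIDE 4 = 7; NO `(P, l)`-level binder).** `ABC` from, per `λ`-line point `P`, prime `l` and genuine
Θ-volume datum `T : Cor22.ThetaVolumeDatumAt P l`: DATA = Dupuy–Hilado pilot data `X P l T` over `T.F`, the context binders of c312-7's
print-normalised real setting, Θ-ideles and q-ideles, PR-1's `ρ`, `qK` (exactly `abc_of_S_shrink2`'s); HYPOTHESES = [SIDE] `hX` (`X P l T` is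
the pilot data OF `T.D`), `htq0`, `htq1`, `htq` (q-ideles realise `P_q`) · [S] `hS` · [PIN] `hPin` (two pins) · [READ] `hΘP` (every global
possible image has procession-normalised log-volume `≤ T.negLogThetaPerImage`). Compared with `abc_of_S_shrink2`: NO `ht0`/`ht1`, NO `hΘ`,
NO `hvol`. Proof: §1 at `T.D`, `T.I`, `T.isVolumeInputOf` gives `Cor22.Cor312PerImageAtDatum P l`; then abc-iut-S2's `ABC_of_cor312PerImage`.
«`ABC` follows from S + these hypotheses as typed, at these data» — a composition record at realising Θ-ideles (C-R10a, p430714); no side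
taken on [IUTchIII] Cor. 3.12 or on (U)/(P); typed ≠ proved; instantiated ≠ endorsed. [claim: Mochizuki2012, status: disputed] -/
theorem abc_of_S_perImage_genuine
    -- DATA, per datum: pilot data over `T.F`, the context binders of the genuine real setting (logs FIXED: analytic), ideles, ρ, qK
    (X : ∀ (P : NFPoint) (l : ℕ) (T : Cor22.ThetaVolumeDatumAt P l), @PilotData T.F T.instFieldF T.instNumberFieldF)
    (M : ∀ (P : NFPoint) (l : ℕ) (T : Cor22.ThetaVolumeDatumAt P l), Type) [∀ P l T, Field (M P l T)] [∀ P l T, NumberField (M P l T)]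
    (archPk : ∀ (P : NFPoint) (l : ℕ) (T : Cor22.ThetaVolumeDatumAt P l), letI := T.instFieldF; letI := T.instNumberFieldF;
      ∀ (j : (thetaIndex (X P l T)).Label) (vQ : (thetaIndex (X P l T)).VQ), Set ((logShellsDH (X P l T) (analyticLogv T.F)).Packet j vQ))
    (archSub : ∀ (P : NFPoint) (l : ℕ) (T : Cor22.ThetaVolumeDatumAt P l), letI := T.instFieldF; letI := T.instNumberFieldF;
      ∀ (j : (thetaIndex (X P l T)).Label) (v : (thetaIndex (X P l T)).V), Set ((logShellsDH (X P l T) (analyticLogv T.F)).Packet j ((thetaIndex (X P l T)).over v)))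
    (Ψ : ∀ (P : NFPoint) (l : ℕ) (T : Cor22.ThetaVolumeDatumAt P l), letI := T.instFieldF; letI := T.instNumberFieldF;
      ℤ → ∀ v : (thetaIndex (X P l T)).V, v ∈ (thetaIndex (X P l T)).Vbad → Set ((logShellsDH (X P l T) (analyticLogv T.F)).StarPacket v))
    (act : ∀ (P : NFPoint) (l : ℕ) (T : Cor22.ThetaVolumeDatumAt P l), letI := T.instFieldF; letI := T.instNumberFieldF;
      ℤ → ∀ v : (thetaIndex (X P l T)).V, v ∈ (thetaIndex (X P l T)).Vbad → (logShellsDH (X P l T) (analyticLogv T.F)).StarPacket v → Module.End ℚ ((logShellsDH (X P l T) (analyticLogv T.F)).StarPacket v))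
    (Mmod : ∀ (P : NFPoint) (l : ℕ) (T : Cor22.ThetaVolumeDatumAt P l), letI := T.instFieldF; letI := T.instNumberFieldF;
      ℤ → ∀ j : (thetaIndex (X P l T)).LabelStar, Set ((logShellsDH (X P l T) (analyticLogv T.F)).GlobalPacket j.1))
    (region : ∀ (P : NFPoint) (l : ℕ) (T : Cor22.ThetaVolumeDatumAt P l), letI := T.instFieldF; letI := T.instNumberFieldF;
      ℤ → ∀ j : (thetaIndex (X P l T)).LabelStar, FinDivisor (M P l T) → ∀ vQ : (thetaIndex (X P l T)).VQ, Set ((logShellsDH (X P l T) (analyticLogv T.F)).Packet j.1 vQ))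
    (frobAdm : ∀ (P : NFPoint) (l : ℕ) (T : Cor22.ThetaVolumeDatumAt P l), letI := T.instFieldF; letI := T.instNumberFieldF;
      ℤ → ℤ → ∀ (j : (thetaIndex (X P l T)).Label) (vQ : (thetaIndex (X P l T)).VQ), Set ((logShellsDH (X P l T) (analyticLogv T.F)).Packet j vQ) → Prop)
    (frobLogvol : ∀ (P : NFPoint) (l : ℕ) (T : Cor22.ThetaVolumeDatumAt P l), letI := T.instFieldF; letI := T.instNumberFieldF;
      ℤ → ℤ → ∀ (j : (thetaIndex (X P l T)).Label) (vQ : (thetaIndex (X P l T)).VQ), Set ((logShellsDH (X P l T) (analyticLogv T.F)).Packet j vQ) → ℝ)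
    (frobMmod : ∀ (P : NFPoint) (l : ℕ) (T : Cor22.ThetaVolumeDatumAt P l), letI := T.instFieldF; letI := T.instNumberFieldF;
      ℤ → ℤ → ∀ j : (thetaIndex (X P l T)).LabelStar, Set ((logShellsDH (X P l T) (analyticLogv T.F)).GlobalPacket j.1))
    (unitImage : ∀ (P : NFPoint) (l : ℕ) (T : Cor22.ThetaVolumeDatumAt P l), letI := T.instFieldF; letI := T.instNumberFieldF;
      ℤ → ℤ → ℕ → ∀ (j : (thetaIndex (X P l T)).Label) (vQ : (thetaIndex (X P l T)).VQ), Set ((logShellsDH (X P l T) (analyticLogv T.F)).Packet j vQ))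
    (ballImage : ∀ (P : NFPoint) (l : ℕ) (T : Cor22.ThetaVolumeDatumAt P l), letI := T.instFieldF; letI := T.instNumberFieldF;
      ℤ → ℤ → ∀ (j : (thetaIndex (X P l T)).Label) (vQ : (thetaIndex (X P l T)).VQ), Set ((logShellsDH (X P l T) (analyticLogv T.F)).Packet j vQ))
    (thetaDiv : ∀ (P : NFPoint) (l : ℕ) (T : Cor22.ThetaVolumeDatumAt P l), letI := T.instFieldF; letI := T.instNumberFieldF;
      ℤ → ℤ → LgpDivisor (M P l T) (thetaIndex (X P l T)).lstar)
    (n : ∀ (P : NFPoint) (l : ℕ) (T : Cor22.ThetaVolumeDatumAt P l), ℤ)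
    {HT : ∀ (P : NFPoint) (l : ℕ) (T : Cor22.ThetaVolumeDatumAt P l), Type} {LogLink : ∀ (P : NFPoint) (l : ℕ) (T : Cor22.ThetaVolumeDatumAt P l), HT P l T → HT P l T → Type}
    {IsFull : ∀ (P : NFPoint) (l : ℕ) (T : Cor22.ThetaVolumeDatumAt P l), ∀ {s t : HT P l T}, LogLink P l T s t → Prop}
    (lat : ∀ (P : NFPoint) (l : ℕ) (T : Cor22.ThetaVolumeDatumAt P l), LGPGaussianLogThetaLattice (LogLink P l T) (IsFull P l T))
    {Frd : ∀ (P : NFPoint) (l : ℕ) (T : Cor22.ThetaVolumeDatumAt P l), Type} {IsoF : ∀ (P : NFPoint) (l : ℕ) (T : Cor22.ThetaVolumeDatumAt P l), Frd P l T → Frd P l T → Type} {Ob : ∀ (P : NFPoint) (l : ℕ) (T : Cor22.ThetaVolumeDatumAt P l), Frd P l T → Type}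
    {realify : ∀ (P : NFPoint) (l : ℕ) (T : Cor22.ThetaVolumeDatumAt P l), Frd P l T → Frd P l T} {Strip : ∀ (P : NFPoint) (l : ℕ) (T : Cor22.ThetaVolumeDatumAt P l), Type} {IsoS : ∀ (P : NFPoint) (l : ℕ) (T : Cor22.ThetaVolumeDatumAt P l), Strip P l T → Strip P l T → Type}
    {Mv : ∀ (P : NFPoint) (l : ℕ) (T : Cor22.ThetaVolumeDatumAt P l), letI := T.instFieldF; letI := T.instNumberFieldF;
      ∀ v : (thetaIndex (X P l T)).V, v ∈ (thetaIndex (X P l T)).Vbad → Type}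
    [∀ P l T v h, Monoid (Mv P l T v h)]
    (sig : ∀ (P : NFPoint) (l : ℕ) (T : Cor22.ThetaVolumeDatumAt P l), letI := T.instFieldF; letI := T.instNumberFieldF;
      GlobalLGPFrobenioidSignature (thetaIndex (X P l T)).lstar (thetaIndex (X P l T)).V (· ∈ (thetaIndex (X P l T)).Vbad) (Frd P l T) (IsoF P l T) (Ob P l T) (realify P l T)
        (Strip P l T) (IsoS P l T) (Mv P l T))
    (split : ∀ (P : NFPoint) (l : ℕ) (T : Cor22.ThetaVolumeDatumAt P l), SplittingMonoids (Mv P l T))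
    {ObΔ : ∀ (P : NFPoint) (l : ℕ) (T : Cor22.ThetaVolumeDatumAt P l), Type} {N : ∀ (P : NFPoint) (l : ℕ) (T : Cor22.ThetaVolumeDatumAt P l), letI := T.instFieldF; letI := T.instNumberFieldF;
      ∀ v : (thetaIndex (X P l T)).V, v ∈ (thetaIndex (X P l T)).Vbad → Type}
    [∀ P l T v h, Monoid (N P l T v h)] (qData : ∀ (P : NFPoint) (l : ℕ) (T : Cor22.ThetaVolumeDatumAt P l), QPilotData (ObΔ P l T) (N P l T))
    (t : ∀ (P : NFPoint) (l : ℕ) (T : Cor22.ThetaVolumeDatumAt P l), letI := T.instFieldF; letI := T.instNumberFieldF;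
      ∀ (pp : Nat.Primes) (_ : Fin (X P l T).lstar) (x : (thetaIndex (X P l T)).Fibre (.inr pp)), haveI : Fact (pp : ℕ).Prime := ⟨pp.2⟩; kOf (X P l T) pp.1 x)
    (tq : ∀ (P : NFPoint) (l : ℕ) (T : Cor22.ThetaVolumeDatumAt P l), letI := T.instFieldF; letI := T.instNumberFieldF;
      ∀ (pp : Nat.Primes) (x : (thetaIndex (X P l T)).Fibre (.inr pp)), haveI : Fact (pp : ℕ).Prime := ⟨pp.2⟩; kOf (X P l T) pp.1 x)
    (ρ : ∀ (P : NFPoint) (l : ℕ) (T : Cor22.ThetaVolumeDatumAt P l), letI := T.instFieldF; letI := T.instNumberFieldF;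
      (∀ v : (thetaIndex (X P l T)).V, v ∈ (thetaIndex (X P l T)).Vbad → Set ((logShellsDH (X P l T) (analyticLogv T.F)).StarPacket v)) → ∀ (j : (thetaIndex (X P l T)).Label) (vQ : (thetaIndex (X P l T)).VQ), Set ((logShellsDH (X P l T) (analyticLogv T.F)).Packet j vQ))
    (qK : ∀ (P : NFPoint) (l : ℕ) (T : Cor22.ThetaVolumeDatumAt P l), letI := T.instFieldF; letI := T.instNumberFieldF;
      ∀ v : (thetaIndex (X P l T)).V, v ∈ (thetaIndex (X P l T)).Vbad → Set ((logShellsDH (X P l T) (analyticLogv T.F)).StarPacket v))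
    -- [SIDE] `X` is the pilot data OF `T.D`; the q-ideles are non-zero, units off `S`, and REALISE `P_q` (no Θ-idele condition)
    (hX : ∀ (P : NFPoint) (l : ℕ) (T : Cor22.ThetaVolumeDatumAt P l), letI := T.instFieldF; letI := T.instNumberFieldF; letI := T.instAlgebraF; letI := T.instFieldK;
        letI := T.instNumberFieldK; letI := T.instAlgebraK; letI := T.instFieldFbar; letI := T.instAlgebraFbar;
        letI := T.instAlgebraKFbar; letI := T.instIsElliptic;
      Cor312Prov.IsPilotDataOf T.D (X P l T))
    (htq0 : ∀ P l T pp x, tq P l T pp x ≠ 0)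
    (htq1 : ∀ (P : NFPoint) (l : ℕ) (T : Cor22.ThetaVolumeDatumAt P l), letI := T.instFieldF; letI := T.instNumberFieldF;
      ∀ (pp : Nat.Primes) (x : (thetaIndex (X P l T)).Fibre (.inr pp)),
        haveI : Fact (pp : ℕ).Prime := ⟨pp.2⟩; placeOf (X P l T) pp.1 x ∉ (X P l T).S → ‖tq P l T pp x‖ = 1)
    (htq : ∀ (P : NFPoint) (l : ℕ) (T : Cor22.ThetaVolumeDatumAt P l), letI := T.instFieldF; letI := T.instNumberFieldF;
      ∀ (pp : Nat.Primes) (x : (thetaIndex (X P l T)).Fibre (.inr pp)),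
        haveI : Fact (pp : ℕ).Prime := ⟨pp.2⟩
        Real.log ‖tq P l T pp x‖ = -((X P l T).qPilot (placeOf (X P l T) pp.1 x)) * logNorm T.F (placeOf (X P l T) pp.1 x) /
          localDegree T.F (placeOf (X P l T) pp.1 x))
    -- [S] the single named proposition, at every datum, AT THESE DATA
    (hS : ∀ (P : NFPoint) (l : ℕ) (T : Cor22.ThetaVolumeDatumAt P l), letI := T.instFieldF; letI := T.instNumberFieldF;
      Cor312Vol.PilotKummerIndRelated
        (LatticeSituation.ofShells (logShellsDH (X P l T) (analyticLogv T.F)) (M P l T) (archPk P l T)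
          (archSub P l T) (summandPiecesPr (X P l T) (logvAnalytic_analyticLogv (F := T.F))).Adm
          (summandPiecesPr (X P l T) (logvAnalytic_analyticLogv (F := T.F))).logvol (Ψ P l T) (act P l T) (Mmod P l T)
          (region P l T) (frobAdm P l T) (frobLogvol P l T) (fun k _ => Ψ P l T k) (frobMmod P l T) (unitImage P l T)
          (ballImage P l T) (thetaDiv P l T))
        (settingPrVolSharp (X P l T) (logvAnalytic_analyticLogv (F := T.F)) (M P l T) (archPk P l T) (archSub P l T) (Ψ P l T)
          (act P l T) (Mmod P l T) (region P l T) (n P l T) (lat P l T) (sig P l T) (split P l T) (qData P l T) (tq P l T)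
          (t P l T) (htq0 P l T) (htq1 P l T)) (ρ P l T) (qK P l T))
    -- [PIN] the Corollary's own region pins (pΘ)(pq′), AT THESE DATA (`hBridge` is no longer a binder: p424856)
    (hPin : ∀ (P : NFPoint) (l : ℕ) (T : Cor22.ThetaVolumeDatumAt P l), letI := T.instFieldF; letI := T.instNumberFieldF;
      Cor312Vol.PinnedRegions
        (LatticeSituation.ofShells (logShellsDH (X P l T) (analyticLogv T.F)) (M P l T) (archPk P l T)
          (archSub P l T) (summandPiecesPr (X P l T) (logvAnalytic_analyticLogv (F := T.F))).Adm
          (summandPiecesPr (X P l T) (logvAnalytic_analyticLogv (F := T.F))).logvol (Ψ P l T) (act P l T) (Mmod P l T)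
          (region P l T) (frobAdm P l T) (frobLogvol P l T) (fun k _ => Ψ P l T k) (frobMmod P l T) (unitImage P l T)
          (ballImage P l T) (thetaDiv P l T))
        (settingPrVolSharp (X P l T) (logvAnalytic_analyticLogv (F := T.F)) (M P l T) (archPk P l T) (archSub P l T) (Ψ P l T)
          (act P l T) (Mmod P l T) (region P l T) (n P l T) (lat P l T) (sig P l T) (split P l T) (qData P l T) (tq P l T)
          (t P l T) (htq0 P l T) (htq1 P l T)) (ρ P l T) (qK P l T))
    -- [FACT] (none) · [CONE] (none: (ii)(b)@n is `rfl` in the strictified reading; NO (ii′) binder — the per-image estimate is a theorem)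
    -- [READ] the per-image Θ-side reading: every global possible image of the genuine setting has procession-normalised log-volume
    --   ≤ the datum's −|log(Θ)|_(P) (`hq` is no longer a binder: c312-7 ∘ c312-8)
    (hΘP : ∀ (P : NFPoint) (l : ℕ) (T : Cor22.ThetaVolumeDatumAt P l), letI := T.instFieldF; letI := T.instNumberFieldF;
      ∀ U : ImageChoice
        (settingPrVolSharp (X P l T) (logvAnalytic_analyticLogv (F := T.F)) (M P l T) (archPk P l T) (archSub P l T) (Ψ P l T)
          (act P l T) (Mmod P l T) (region P l T) (n P l T) (lat P l T) (sig P l T) (split P l T) (qData P l T) (tq P l T)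
          (t P l T) (htq0 P l T) (htq1 P l T)),
        processionNormalized (fun i : Fin (thetaIndex (X P l T)).lstar =>
          ∑ᶠ vQ : (thetaIndex (X P l T)).VQ,
            ((LatticeSituation.ofShells (logShellsDH (X P l T) (analyticLogv T.F)) (M P l T) (archPk P l T)
                (archSub P l T) (summandPiecesPr (X P l T) (logvAnalytic_analyticLogv (F := T.F))).Adm
                (summandPiecesPr (X P l T) (logvAnalytic_analyticLogv (F := T.F))).logvol (Ψ P l T) (act P l T) (Mmod P l T)
                (region P l T) (frobAdm P l T) (frobLogvol P l T) (fun k _ => Ψ P l T k) (frobMmod P l T) (unitImage P l T)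
                (ballImage P l T) (thetaDiv P l T)).D
              (settingPrVolSharp (X P l T) (logvAnalytic_analyticLogv (F := T.F)) (M P l T) (archPk P l T) (archSub P l T)
                (Ψ P l T) (act P l T) (Mmod P l T) (region P l T) (n P l T) (lat P l T) (sig P l T) (split P l T) (qData P l T)
                (tq P l T) (t P l T) (htq0 P l T) (htq1 P l T)).n).logvol (Setting.labelSucc i) vQ (U.1 (i, vQ))) ≤
          T.negLogThetaPerImage) :
    _root_.ABC :=
  -- [IUTchIII] Cor 3.12 READ PER IMAGE at EVERY genuine Θ-volume datum, AT ITS GENUINE REAL SETTING (§1 under `T`'s bundled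
  -- instances), then abc-iut-S2's hvol-free endpoint
  ABC_of_cor312PerImage fun P _ l _ _ _ _ _ _ T => by
    letI := T.instFieldF; letI := T.instNumberFieldF; letI := T.instAlgebraF; letI := T.instFieldK
    letI := T.instNumberFieldK; letI := T.instAlgebraK; letI := T.instFieldFbar; letI := T.instAlgebraFbar
    letI := T.instAlgebraKFbar; letI := T.instIsElliptic
    exact PerImage.cor312PerImageOf_of_S_genuine T.D (X P l T) (M P l T) (archPk P l T) (archSub P l T) (Ψ P l T) (act P l T)
      (Mmod P l T) (region P l T) (frobAdm P l T) (frobLogvol P l T) (frobMmod P l T) (unitImage P l T) (ballImage P l T)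
      (thetaDiv P l T) (n P l T) (lat P l T) (sig P l T) (split P l T) (qData P l T) (t P l T) (tq P l T) (ρ P l T) (qK P l T)
      T.isVolumeInputOf (hX P l T) (htq0 P l T) (htq1 P l T) (htq P l T) (hS P l T) (hPin P l T) (hΘP P l T)

end Family

end Summit.ABC.IUTFork.Conditional

end
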